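import Literature.MathematicalPhysics.QuantumLattice.SymmetricRegimeCertificateR
import HarnessLib

/-!
# The symmetric-regime certificate with a DEGREE-TRUNCATED remainder (v3, `T`)

Topic `Literature/MathematicalPhysics/QuantumLattice`; definition request
`defn-symmetricRegimeCertificateT` (D1′b-v3 of route HubbardSuperconductivity/AposterioriCapRg, the
route-repair of stmt-14026 after refuter rattack-14026's verdict M1″, 2026-08-16; it types the producer
crux `CapRgSymmetricCertificatePinned` = stmt-14026 and the hypothesis of
`SeededBrokenRegimeBoseFermiPinned` = stmt-14042).  A v3 UNDER NEW NAMES on top of v2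
(`SymmetricRegimeCertificateR.lean`, p72167) and v1 (`SymmetricRegimeFunctionals.lean`,
`SymmetricRegimeCertificate.lean`), which are imported and left untouched: every v1 functional
(`vertexSupNorm`, `remainderWeightNorm`, `selfEnergy`, `omega0`, `momentumShell`, `fieldStrengthSpin`,
`cooperMatrix`, `CooperDominance`, `pairingStrength`, `stonerCharge`/`stonerSpin`, `ShellGeometry`,
`renormalisedBandC`, the window constants) and both v2 records (`SymmetricRegimeDataR`,
`SymmetricTolerance`, the literal `capRgCornerData`) are REUSED unchanged.

## Why a v3 (refuter rattack-14026 M1″; planner evidence REPAIR_14026.md §1–§3)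

v2 froze clause (i′b) as the FULL degree sum `remainderWeightNorm L M β (h_r² Λ) G ≤ E₃`, i.e.
`Σ_{m ∉ {0,2,4}, m ≤ |Γ|} h_r^{m-4} Λ^{(m-4)/2} ‖𝒱_m‖_∞ ≤ E₃` with `|Γ| = 8L²M` (`card_hubbardFieldIdx`).
In the v1 normalisation `𝒱_m = m!·ε^{1-m}·F_m` (sup norm of the coefficient of the SORTED monomial) the
tree-level zero-transfer forward-scattering graphs give `Λ^{n-1}‖𝒱_{2n+2}‖_∞ ≥ n!·U^n` (the `n!`
spectator orderings add coherently), so under `∀ β ∀ M` that sum diverges factorially at EVERY field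
radius `h_r > 0`: v2's predicate is never instantiated at `U > 0`.  The adopted repair (refuter's C‴)
truncates the degree at a pinned `m_max` carried by the physical data (three ball-norm alternatives
were examined by the planner and deliberately not pinned, REPAIR_14026.md §3):

* `SymmetricRegimeDataT extends SymmetricRegimeDataR` by `remainderDegree : ℕ` (`m_max`);
* `remainderWeightNormUpTo L M m_max β Λ G = Σ_{m ≤ m_max, m ∉ {0,2,4}} Λ^{(m-4)/2} ‖𝒱_m‖_∞` — the v1
  summands, truncated: `≤` the v1 sum when `m_max ≤ |Γ|` (`remainderWeightNormUpTo_le_remainderWeightNorm`)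
  and `=` it at `m_max = |Γ|` (`remainderWeightNormUpTo_card`);
* `SymmetricCertifiedAtT π Θ a b Λ L M β e G Z` — v2's seven clauses VERBATIM, in the same order,
  except (i′b) := `remainderWeightNormUpTo L M π.remainderDegree β (h_r² Λ) G ≤ E₃`
  (`= Σ_{m ≤ m_max, m ∉ {0,2,4}} h_r^{m-4} Λ^{(m-4)/2} ‖𝒱_m‖_∞`, `remainderWeightNormUpTo_radius`).  Since
  degrees `0, 2, 4` are excluded and odd degrees of an even `G` vanish, at `m_max = 10` it charges
  `‖𝒱₆‖, ‖𝒱₈‖, ‖𝒱₁₀‖` only (tree value at `(U, h_r) = (3, 1/4)`, planner REPAIR_14026.md §2: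
  `Σ_{n=2}^{4} n!·U^n·h_r^{2n-2} = 2·9/16 + 6·27/256 + 24·81/4096 ≈ 2.23 ≤ 32 = E₃`).  It is a bound on
  FINITELY MANY PINNED DEGREES — NOT a tail bound and NOT an analyticity (Banach-ball) bound on `G`;
  nothing whatsoever is asserted about the degrees `m > m_max`;
* `SymmetricRegimeHoldsT`, `symmetricRegimeCertificateT U μ π Θ K Λ L₀` — v2's bodies verbatim with
  `AtR ↦ AtT`: frame admissible, `Λ ∈ [Λ₁, Λ₂]`, shell geometry, and ONE rational enclosure
  `1/8 ≤ a ≤ b ≤ 1/5`, `b - a ≤ w`, bound OUTSIDE the `∀ L ∃ β₀ ∀ β ∃ M₀ ∀ M` block; the model binding is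
  v1/v2's (`nambuXiCT L μ K`, `hubbardEffectiveActionCT L M β U μ 0 K Λ`,
  `hubbardEffPartitionFnCT L M β U μ 0 K Λ`, frame norm `K.coeffNorm π.frameDecay`, continuum band
  `renormalisedBandC μ K`);
* `capRgCornerDataT := { capRgCornerData with remainderDegree := 10 }` — the route's literal `π₀`, ONE
  named constant for producer and consumer (numerals: v2's, plus `m_max = 10`).

## API (all proved)

`card_hubbardFieldIdx` (`|Γ| = 8L²M`), `le_card_hubbardFieldIdx` (`M ≤ |Γ|`); `remainderWeightNormUpTo_nonneg`,
`_zero`, `_mono` (in `m_max`), `_card`, `_le_remainderWeightNorm`, `_radius`; unfoldings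
`symmetricCertifiedAtT_iff`, `symmetricRegimeHoldsT_iff`, `symmetricRegimeCertificateT_iff` (`Iff.rfl`);
projections `SymmetricCertifiedAtT.ne_zero`, `.mismatch_le`, `.fieldStrength_mem`, `.quartic_le`,
`.remainder_le`, `.cooperDominance`, `.stoner_le`, `.window`, `.mono_window`;
`SymmetricRegimeHoldsT.admitsFrameNorm`, `.admitsScale`, `.scale_pos`, `.shellGeometry`, `.mono`,
`.exists_window`; `symmetricRegimeCertificateT.coeffNorm_le`, `.admitsScale`, `.scale_pos`,
`.shellGeometry`, `.mono`; the WEAKENINGS v2 ⇒ v3 `SymmetricCertifiedAtT.of_R` (`0 ≤ Λ`, `m_max ≤ |Γ|`),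
`SymmetricRegimeHoldsT.of_R` and `symmetricRegimeCertificateT.of_R` (unconditional: `|Γ| = 8L²M ≥ M`
absorbs `m_max` into `M₀`); the junk tests `not_symmetricCertifiedAtT_zero` (`a > 0`),
`not_symmetricRegimeHoldsT_zero`, `not_symmetricRegimeCertificateT_free` (`U = 0`, `K = 0` ⇒ FALSE via
`hubbardEffectiveActionCT_free_zero_frame`); `capRgCornerDataT` field values by `rfl`.

## NOT claimed

No instance of any predicate at `U > 0` (that is crux stmt-14026); nothing about any model beyond the
`U = 0` junk test; no bound on degrees above `m_max`; v1 and v2 are not edited.  The records and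
predicates are posited by the route (a-posteriori format, Figueras–Haro–Luque 2016 Thm. 2.5), like v1,
v2 and `HubbardScaleData`.

## Sources

M. Salmhofer, Commun. Math. Phys. 194 (1998) 249, §4.1–4.2 Thm. 1 (scale- and `h`-weighted norms of
the kernels, `‖G̃_{mr}(t)‖ ≤ γ_{mr} e^{t(m/2-2)}`), §5.3 (sup norms `|F_m|₀`) [`Salmhofer1998`];
J. Feldman, M. Salmhofer, E. Trubowitz, J. Stat. Phys. 84 (1996) 1209, §1 (the counterterm frame)
[`FeldmanSalmhoferTrubowitz1996`]; J.-Ll. Figueras, A. Haro, A. Luque, Found. Comput. Math. 17 (2017)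
1123, Thm. 2.5 (a-posteriori format) [`FiguerasHaroLuque2016`]; v1/v2 files for everything reused;
planner evidence REPAIR_14026.md (the numerals and the truncation).
-/

noncomputable section

namespace Literature.MathematicalPhysics.QuantumLattice

open Literature.Probability.LatticeModels GrassmannAlgebra Finset Matrix

/-! ### §1 The record and the literal corner data -/

/-- **Physical data of the symmetric regime with a field radius AND a remainder degree** (`π` of
request D1′b-v3): the v2 record `SymmetricRegimeDataR` (v1 data + frame decay exponent `r`, remainder
bound `E₃ > 0`, field radius `0 < h_r ≤ 1`, slope allowance `c₁ ≥ 0`) EXTENDED by the highest degree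
`m_max` charged by the remainder clause (i′b): the `h_r`-weighted sum of Salmhofer's sup norms is taken
over the degrees `m ≤ m_max`, `m ∉ {0, 2, 4}` only.  A finite decidable object; nothing about any model
is asserted by inhabiting it. [cite: Salmhofer1998, §4.1–4.2 Thm. 1 and §5.3 (h-weighted sup norms, degree by degree)] -/
structure SymmetricRegimeDataT extends SymmetricRegimeDataR where
  /-- `m_max`: the highest degree charged by the remainder clause (i′b). -/
  remainderDegree : ℕ

/-- **The route's literal corner data `π₀` (v3)**: v2's `capRgCornerData` (frameBound `10`, frameDecay
`4`, quarticBound `4`, remainderBound `32`, fieldRadius `1/4`, slopeAllowance `1/2`, stonerMargin `1/4`,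
fieldFloor `1/2`, velLower `1/2`, velUpper `4`, curvLower `1/25`, curvUpper `3`, vanHoveDist `1/2`,
scaleLower `1/100`, scaleUpper `3/10`) with `remainderDegree := 10` (planner REPAIR_14026.md §2: degrees
`6, 8, 10` charged; tree value `≈ 2.23 ≤ 32` at `(U, h_r) = (3, 1/4)`).  ONE named constant for producer
and consumer; nothing is claimed about it. [folklore] -/
def capRgCornerDataT : SymmetricRegimeDataT :=
  { capRgCornerData with remainderDegree := 10 }

/-- The corner data's remainder degree is `10`. [folklore] -/
@[simp] theorem capRgCornerDataT_remainderDegree : capRgCornerDataT.remainderDegree = 10 := rfl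
/-- The corner data's v2 part is v2's `capRgCornerData`. [folklore] -/
@[simp] theorem capRgCornerDataT_toSymmetricRegimeDataR :
    capRgCornerDataT.toSymmetricRegimeDataR = capRgCornerData := rfl
/-- The corner data's field radius is `1/4`. [folklore] -/
@[simp] theorem capRgCornerDataT_fieldRadius : capRgCornerDataT.fieldRadius = 1 / 4 := rfl
/-- The corner data's remainder bound is `32`. [folklore] -/
@[simp] theorem capRgCornerDataT_remainderBound : capRgCornerDataT.remainderBound = 32 := rfl
/-- The corner data's frame decay exponent is `4` and frame bound `10`. [folklore] -/
theorem capRgCornerDataT_frame : capRgCornerDataT.frameDecay = 4 ∧ capRgCornerDataT.frameBound = 10 :=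
  ⟨rfl, rfl⟩
/-- The corner data's quartic bound is `4`, Stoner margin `1/4`, field floor `1/2`, slope allowance
`1/2`. [folklore] -/
theorem capRgCornerDataT_bounds :
    capRgCornerDataT.quarticBound = 4 ∧ capRgCornerDataT.stonerMargin = 1 / 4 ∧
      capRgCornerDataT.fieldFloor = 1 / 2 ∧ capRgCornerDataT.slopeAllowance = 1 / 2 :=
  ⟨rfl, rfl, rfl, rfl⟩
/-- The corner data's scale range is `[1/100, 3/10]`. [folklore] -/
theorem capRgCornerDataT_scale :
    capRgCornerDataT.scaleLower = 1 / 100 ∧ capRgCornerDataT.scaleUpper = 3 / 10 := ⟨rfl, rfl⟩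

/-! ### §2 The degree-truncated remainder -/

section Radius

variable (L M : ℕ) [NeZero L]

/-- **`|Γ| = 8 L² M`**: the number of field labels `((ω, k⃗), σ, c)` of the Hubbard torus at `2M`
Matsubara frequencies. [folklore] -/
theorem card_hubbardFieldIdx : Fintype.card (HubbardFieldIdx L M) = 8 * L ^ 2 * M := by
  simp only [Fintype.card_prod, Fintype.card_fin, Fintype.card_fun, ZMod.card]
  ring

/-- `M ≤ |Γ|` (`L ≥ 1`). [folklore] -/
theorem le_card_hubbardFieldIdx : M ≤ Fintype.card (HubbardFieldIdx L M) := by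
  rw [card_hubbardFieldIdx]
  exact Nat.le_mul_of_pos_left M (mul_pos (by norm_num) (pow_pos (NeZero.pos L) 2))

/-- The **degree-truncated weighted remainder** `Σ_{m ≤ m_max, m ∉ {0,2,4}} Λ^{(m-4)/2} ‖𝒱_m‖_∞`: the
summands of v1's `remainderWeightNorm` (Salmhofer's sup norms `‖𝒱_m‖_∞` weighted by the inverse of
their power-counting size `Λ^{-(m-4)/2}`, `‖G_m(t)‖ ≲ e^{t(m/2-2)}`), restricted to the degrees
`m ≤ m_max`.  At the rescaled argument `h²Λ` it is the `h`-weighted truncated sum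
(`remainderWeightNormUpTo_radius`).  A bound on it constrains finitely many pinned degrees and is NOT a
tail or analyticity bound. [cite: Salmhofer1998, §4.2 Thm. 1 (power counting) and §5.3 (sup norms)] -/
def remainderWeightNormUpTo (mMax : ℕ) (β Λ : ℝ) (G : HubbardGrassmann L M) : ℝ :=
  ∑ m ∈ (Finset.range (mMax + 1)).filter (fun m => m ≠ 0 ∧ m ≠ 2 ∧ m ≠ 4),
    Λ ^ (((m : ℝ) - 4) / 2) * vertexSupNorm L M β G m

/-- The truncated remainder is nonnegative (`Λ ≥ 0`). [folklore] -/
theorem remainderWeightNormUpTo_nonneg {Λ : ℝ} (hΛ : 0 ≤ Λ) (mMax : ℕ) (β : ℝ) (G : HubbardGrassmann L M) :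
    0 ≤ remainderWeightNormUpTo L M mMax β Λ G :=
  Finset.sum_nonneg fun m _ => mul_nonneg (Real.rpow_nonneg hΛ _) (vertexSupNorm_nonneg L M β G m)

omit [NeZero L] in
/-- The zero polynomial has truncated remainder `0`. [folklore] -/
@[simp] theorem remainderWeightNormUpTo_zero (mMax : ℕ) (β Λ : ℝ) :
    remainderWeightNormUpTo L M mMax β Λ (0 : HubbardGrassmann L M) = 0 := by
  simp [remainderWeightNormUpTo]

/-- The truncated remainder is monotone in the truncation degree (`Λ ≥ 0`). [folklore] -/
theorem remainderWeightNormUpTo_mono {Λ : ℝ} (hΛ : 0 ≤ Λ) {m₁ m₂ : ℕ} (hm : m₁ ≤ m₂) (β : ℝ)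
    (G : HubbardGrassmann L M) :
    remainderWeightNormUpTo L M m₁ β Λ G ≤ remainderWeightNormUpTo L M m₂ β Λ G := by
  refine Finset.sum_le_sum_of_subset_of_nonneg (fun m h => ?_) fun m _ _ =>
    mul_nonneg (Real.rpow_nonneg hΛ _) (vertexSupNorm_nonneg L M β G m)
  simp only [Finset.mem_filter, Finset.mem_range] at h ⊢
  exact ⟨by omega, h.2⟩

/-- At `m_max = |Γ|` the truncated remainder IS v1's `remainderWeightNorm`. [folklore] -/
theorem remainderWeightNormUpTo_card (β Λ : ℝ) (G : HubbardGrassmann L M) :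
    remainderWeightNormUpTo L M (Fintype.card (HubbardFieldIdx L M)) β Λ G = remainderWeightNorm L M β Λ G :=
  rfl

/-- The truncated remainder is at most v1's full remainder norm (`m_max ≤ |Γ|`, `Λ ≥ 0`). [folklore] -/
theorem remainderWeightNormUpTo_le_remainderWeightNorm {Λ : ℝ} (hΛ : 0 ≤ Λ) {mMax : ℕ}
    (hm : mMax ≤ Fintype.card (HubbardFieldIdx L M)) (β : ℝ) (G : HubbardGrassmann L M) :
    remainderWeightNormUpTo L M mMax β Λ G ≤ remainderWeightNorm L M β Λ G :=
  (remainderWeightNormUpTo_mono L M hΛ hm β G).trans_eq (remainderWeightNormUpTo_card L M β Λ G)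

omit [NeZero L] in
/-- **At the rescaled argument `h²Λ` the truncated remainder is the `h`-weighted truncated sum**:
`remainderWeightNormUpTo L M m_max β (h² Λ) G = Σ_{m ≤ m_max, m ∉ {0,2,4}} h^{m-4} Λ^{(m-4)/2} ‖𝒱_m‖_∞`
(`h, Λ ≥ 0`; v2's `remainderWeightNorm_radius`, summand by summand). [cite: Salmhofer1998, §4.1–4.2 Thm. 1 (h-weighted norms)] -/
theorem remainderWeightNormUpTo_radius {h Λ : ℝ} (hh : 0 ≤ h) (hΛ : 0 ≤ Λ) (mMax : ℕ) (β : ℝ)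
    (G : HubbardGrassmann L M) :
    remainderWeightNormUpTo L M mMax β (h ^ 2 * Λ) G =
      ∑ m ∈ (Finset.range (mMax + 1)).filter (fun m => m ≠ 0 ∧ m ≠ 2 ∧ m ≠ 4),
        h ^ ((m : ℝ) - 4) * Λ ^ (((m : ℝ) - 4) / 2) * vertexSupNorm L M β G m := by
  unfold remainderWeightNormUpTo
  refine Finset.sum_congr rfl fun m _ => ?_
  rw [Real.mul_rpow (pow_nonneg hh 2) hΛ]
  congr 2
  rw [← Real.rpow_natCast h 2, ← Real.rpow_mul hh]
  congr 1
  push_cast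
  ring

end Radius

/-! ### §3 The predicates -/

section Certificate

variable (π : SymmetricRegimeDataT) (Θ : SymmetricTolerance)

/-- **`SymmetricCertifiedAtT π Θ a b Λ L M β e G Z`: the effective action `G` (normaliser `Z`) at
`(L, M, β)` is certified at scale `Λ` against the physical data `π` to tolerance `Θ`, with the pairing
strength in the GIVEN rational interval `[a, b]`, in the frame with renormalised band `e`** — v2's
clauses verbatim except (i′b): (0a) `Z ≠ 0`; (0b′) pointwise mismatch
`|Re Σ((ω₀,k⃗),σ)| ≤ c₀ Λ + c₁ |e(k⃗)|` on the shell; (0c) field strengths `z(k⃗,σ) ∈ [ζ, 1/ζ]` on the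
shell; (i′a) `‖𝒱₄‖_∞ ≤ E₁`; (i′b)-v3 the DEGREE-TRUNCATED remainder at field radius `h_r`,
`remainderWeightNormUpTo L M m_max β (h_r² Λ) G ≤ E₃` (`= Σ_{m ≤ m_max, m ∉ {0,2,4}} h_r^{m-4} Λ^{(m-4)/2} ‖𝒱_m‖_∞`;
at `m_max = 10` the degrees `6, 8, 10` of an even `G` — NOT a tail/analyticity bound); (ii′) Cooper
dominance with margin `2` of a `B₁g` bottom and the Stoner products `st^c(q⃗), st^s(q⃗) ≤ 1 - σ` at every
transfer `q⃗`; (iii′) `a ≤ λ_d ≤ b`.  (A-posteriori format; posited by route AposterioriCapRg, request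
D1′b-v3.) [cite: FiguerasHaroLuque2016, Thm. 2.5 (a-posteriori format)]
[cite: Salmhofer1998, §4.2 Thm. 1 (power counting of the remainder)] -/
def SymmetricCertifiedAtT (a b : ℚ) (Λ : ℝ) (L M : ℕ) [NeZero L] [NeZero M] (β : ℝ)
    (e : TorusSite 2 L → ℝ) (G : HubbardGrassmann L M) (Z : ℂ) : Prop :=
  Z ≠ 0 ∧
  (∀ k ∈ momentumShell L e Λ, ∀ σ : Fin 2,
    |(selfEnergy L M β G (omega0 M, k) σ).re| ≤ Θ.mismatch * Λ + π.slopeAllowance * |e k|) ∧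
  (∀ k ∈ momentumShell L e Λ, ∀ σ : Fin 2,
    (π.fieldFloor : ℝ) ≤ fieldStrengthSpin L M β G k σ ∧ fieldStrengthSpin L M β G k σ ≤ 1 / π.fieldFloor) ∧
  vertexSupNorm L M β G 4 ≤ π.quarticBound ∧
  remainderWeightNormUpTo L M π.remainderDegree β ((π.fieldRadius : ℝ) ^ 2 * Λ) G ≤ π.remainderBound ∧
  (CooperDominance (cooperMatrix L M β e Λ G) ∧
    ∀ q : TorusSite 2 L, stonerCharge L M β e Λ G q ≤ 1 - π.stonerMargin ∧
      stonerSpin L M β e Λ G q ≤ 1 - π.stonerMargin) ∧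
  ((a : ℝ) ≤ pairingStrength L M β e Λ G ∧ pairingStrength L M β e Λ G ≤ b)

/-- **`SymmetricRegimeHoldsT π Θ n eC Λ L₀ e G Z`: the v3 certificate of a MODEL FAMILY** — frame
admissible (`n ≤ κ_max`), `Λ ∈ [Λ₁, Λ₂]`, the continuum shell obeys the geometric bounds of `π`, and
ONE rational enclosure `1/8 ≤ a ≤ b ≤ 1/5`, `b - a ≤ w`, chosen OUTSIDE the thermodynamic block, such
that for every `L ≥ L₀` there is `β₀` with, for every `β ≥ β₀`, an `M₀` with, for every `M ≥ M₀`,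
`SymmetricCertifiedAtT π Θ a b Λ L M β (e L) (G L M β) (Z L M β)` (v2's body with `AtR ↦ AtT`).
[cite: FiguerasHaroLuque2016, Thm. 2.5 (a-posteriori format)] -/
def SymmetricRegimeHoldsT (frameNormVal : ℝ) (eC : (Fin 2 → ℝ) → ℝ) (Λ : ℝ) (L₀ : ℕ)
    (e : ∀ (L : ℕ) [NeZero L], TorusSite 2 L → ℝ) (G : ∀ (L M : ℕ) [NeZero L], ℝ → HubbardGrassmann L M)
    (Z : ∀ (L M : ℕ) [NeZero L], ℝ → ℂ) : Prop :=
  π.AdmitsFrameNorm frameNormVal ∧ π.AdmitsScale Λ ∧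
  ShellGeometry eC Λ π.velLower π.velUpper π.curvLower π.curvUpper π.vanHoveDist ∧
  ∃ a b : ℚ, symmetricWindowLower ≤ a ∧ a ≤ b ∧ b ≤ symmetricWindowUpper ∧ b - a ≤ Θ.width ∧
    ∀ L : ℕ, L₀ ≤ L → ∀ [NeZero L], ∃ β₀ : ℝ, ∀ β : ℝ, β₀ ≤ β → ∃ M₀ : ℕ, ∀ M : ℕ, M₀ ≤ M → ∀ [NeZero M],
      SymmetricCertifiedAtT π Θ a b Λ L M β (e L) (G L M β) (Z L M β)

/-- **`symmetricRegimeCertificateT U μ π Θ K Λ L₀` — the v3 certificate of the countertermed Hubbard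
effective action** (request D1′b-v3, item (4)): `SymmetricRegimeHoldsT` for the frame regularity norm
`K.coeffNorm π.frameDecay`, the continuum band `renormalisedBandC μ K`, and the families
`e L = nambuXiCT L μ K`, `G L M β = hubbardEffectiveActionCT L M β U μ 0 K Λ`,
`Z L M β = hubbardEffPartitionFnCT L M β U μ 0 K Λ` — the v1/v2 binding with the v3 predicate.
[cite: FeldmanSalmhoferTrubowitz1996, §1 (the counterterm frame)] [cite: FiguerasHaroLuque2016, Thm. 2.5 (a-posteriori format)] -/
def symmetricRegimeCertificateT (U μ : ℝ) (π : SymmetricRegimeDataT) (Θ : SymmetricTolerance)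
    (K : TrigPolyC4v) (Λ : ℝ) (L₀ : ℕ) : Prop :=
  SymmetricRegimeHoldsT π Θ (K.coeffNorm π.frameDecay) (renormalisedBandC μ K) Λ L₀
    (fun L _ => nambuXiCT L μ K)
    (fun L M _ β => hubbardEffectiveActionCT L M β U μ 0 K Λ)
    (fun L M _ β => hubbardEffPartitionFnCT L M β U μ 0 K Λ)

end Certificate

/-! ### §4 API -/

section API

variable {π : SymmetricRegimeDataT} {Θ : SymmetricTolerance}

/-- Unfolding `SymmetricCertifiedAtT` into its seven clauses. [folklore] -/
theorem symmetricCertifiedAtT_iff (π : SymmetricRegimeDataT) (Θ : SymmetricTolerance) (a b : ℚ) (Λ : ℝ)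
    (L M : ℕ) [NeZero L] [NeZero M] (β : ℝ) (e : TorusSite 2 L → ℝ) (G : HubbardGrassmann L M) (Z : ℂ) :
    SymmetricCertifiedAtT π Θ a b Λ L M β e G Z ↔
      Z ≠ 0 ∧
      (∀ k ∈ momentumShell L e Λ, ∀ σ : Fin 2,
        |(selfEnergy L M β G (omega0 M, k) σ).re| ≤ Θ.mismatch * Λ + π.slopeAllowance * |e k|) ∧
      (∀ k ∈ momentumShell L e Λ, ∀ σ : Fin 2,
        (π.fieldFloor : ℝ) ≤ fieldStrengthSpin L M β G k σ ∧
          fieldStrengthSpin L M β G k σ ≤ 1 / π.fieldFloor) ∧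
      vertexSupNorm L M β G 4 ≤ π.quarticBound ∧
      remainderWeightNormUpTo L M π.remainderDegree β ((π.fieldRadius : ℝ) ^ 2 * Λ) G ≤ π.remainderBound ∧
      (CooperDominance (cooperMatrix L M β e Λ G) ∧
        ∀ q : TorusSite 2 L, stonerCharge L M β e Λ G q ≤ 1 - π.stonerMargin ∧
          stonerSpin L M β e Λ G q ≤ 1 - π.stonerMargin) ∧
      ((a : ℝ) ≤ pairingStrength L M β e Λ G ∧ pairingStrength L M β e Λ G ≤ b) :=
  Iff.rfl

section AtT

variable {a b : ℚ} {Λ : ℝ} {L M : ℕ} [NeZero L] [NeZero M] {β : ℝ} {e : TorusSite 2 L → ℝ}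
  {G : HubbardGrassmann L M} {Z : ℂ}

/-- Clause (0a): the normaliser is non-zero. [folklore] -/
theorem SymmetricCertifiedAtT.ne_zero (h : SymmetricCertifiedAtT π Θ a b Λ L M β e G Z) : Z ≠ 0 :=
  h.1

/-- Clause (0b′): the pointwise mismatch bound on the shell. [folklore] -/
theorem SymmetricCertifiedAtT.mismatch_le (h : SymmetricCertifiedAtT π Θ a b Λ L M β e G Z)
    {k : TorusSite 2 L} (hk : k ∈ momentumShell L e Λ) (σ : Fin 2) :
    |(selfEnergy L M β G (omega0 M, k) σ).re| ≤ Θ.mismatch * Λ + π.slopeAllowance * |e k| :=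
  h.2.1 k hk σ

/-- Clause (0c): field strengths in `[ζ, 1/ζ]` on the shell. [folklore] -/
theorem SymmetricCertifiedAtT.fieldStrength_mem (h : SymmetricCertifiedAtT π Θ a b Λ L M β e G Z)
    {k : TorusSite 2 L} (hk : k ∈ momentumShell L e Λ) (σ : Fin 2) :
    (π.fieldFloor : ℝ) ≤ fieldStrengthSpin L M β G k σ ∧ fieldStrengthSpin L M β G k σ ≤ 1 / π.fieldFloor :=
  h.2.2.1 k hk σ

/-- Clause (i′a): `‖𝒱₄‖_∞ ≤ E₁`. [folklore] -/
theorem SymmetricCertifiedAtT.quartic_le (h : SymmetricCertifiedAtT π Θ a b Λ L M β e G Z) :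
    vertexSupNorm L M β G 4 ≤ π.quarticBound :=
  h.2.2.2.1

/-- Clause (i′b)-v3: the degree-truncated radius-weighted remainder is at most `E₃`. [folklore] -/
theorem SymmetricCertifiedAtT.remainder_le (h : SymmetricCertifiedAtT π Θ a b Λ L M β e G Z) :
    remainderWeightNormUpTo L M π.remainderDegree β ((π.fieldRadius : ℝ) ^ 2 * Λ) G ≤ π.remainderBound :=
  h.2.2.2.2.1

/-- Clause (ii′), Cooper part. [folklore] -/
theorem SymmetricCertifiedAtT.cooperDominance (h : SymmetricCertifiedAtT π Θ a b Λ L M β e G Z) :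
    CooperDominance (cooperMatrix L M β e Λ G) :=
  h.2.2.2.2.2.1.1

/-- Clause (ii′), Stoner part. [folklore] -/
theorem SymmetricCertifiedAtT.stoner_le (h : SymmetricCertifiedAtT π Θ a b Λ L M β e G Z)
    (q : TorusSite 2 L) :
    stonerCharge L M β e Λ G q ≤ 1 - π.stonerMargin ∧ stonerSpin L M β e Λ G q ≤ 1 - π.stonerMargin :=
  h.2.2.2.2.2.1.2 q

/-- Clause (iii′): `λ_d ∈ [a, b]`. [folklore] -/
theorem SymmetricCertifiedAtT.window (h : SymmetricCertifiedAtT π Θ a b Λ L M β e G Z) :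
    (a : ℝ) ≤ pairingStrength L M β e Λ G ∧ pairingStrength L M β e Λ G ≤ b :=
  h.2.2.2.2.2.2

/-- Shrinking the interval is monotone: a certificate for `[a, b]` is one for any `[a', b'] ⊇ [a, b]`.
[folklore] -/
theorem SymmetricCertifiedAtT.mono_window {a' b' : ℚ} (ha : a' ≤ a) (hb : b ≤ b')
    (h : SymmetricCertifiedAtT π Θ a b Λ L M β e G Z) : SymmetricCertifiedAtT π Θ a' b' Λ L M β e G Z :=
  ⟨h.1, h.2.1, h.2.2.1, h.2.2.2.1, h.2.2.2.2.1, h.2.2.2.2.2.1,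
    (Rat.cast_le.2 ha).trans h.window.1, h.window.2.trans (Rat.cast_le.2 hb)⟩

/-- **The weakening v2 ⇒ v3 at a point**: a v2 certificate (full remainder sum) for the v2 part of `π`
is a v3 certificate whenever `m_max ≤ |Γ|` (`Λ ≥ 0`), the truncated sum being at most the full one.
[folklore] -/
theorem SymmetricCertifiedAtT.of_R (hΛ : 0 ≤ Λ) (hdeg : π.remainderDegree ≤ Fintype.card (HubbardFieldIdx L M))
    (h : SymmetricCertifiedAtR π.toSymmetricRegimeDataR Θ a b Λ L M β e G Z) :
    SymmetricCertifiedAtT π Θ a b Λ L M β e G Z :=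
  ⟨h.1, h.2.1, h.2.2.1, h.2.2.2.1,
    (remainderWeightNormUpTo_le_remainderWeightNorm L M (mul_nonneg (sq_nonneg _) hΛ) hdeg β G).trans
      h.remainder_le,
    h.2.2.2.2.2.1, h.2.2.2.2.2.2⟩

end AtT

/-- Unfolding `SymmetricRegimeHoldsT`. [folklore] -/
theorem symmetricRegimeHoldsT_iff (π : SymmetricRegimeDataT) (Θ : SymmetricTolerance) (n : ℝ)
    (eC : (Fin 2 → ℝ) → ℝ) (Λ : ℝ) (L₀ : ℕ) (e : ∀ (L : ℕ) [NeZero L], TorusSite 2 L → ℝ)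
    (G : ∀ (L M : ℕ) [NeZero L], ℝ → HubbardGrassmann L M) (Z : ∀ (L M : ℕ) [NeZero L], ℝ → ℂ) :
    SymmetricRegimeHoldsT π Θ n eC Λ L₀ e G Z ↔
      π.AdmitsFrameNorm n ∧ π.AdmitsScale Λ ∧
      ShellGeometry eC Λ π.velLower π.velUpper π.curvLower π.curvUpper π.vanHoveDist ∧
      ∃ a b : ℚ, symmetricWindowLower ≤ a ∧ a ≤ b ∧ b ≤ symmetricWindowUpper ∧ b - a ≤ Θ.width ∧
        ∀ L : ℕ, L₀ ≤ L → ∀ [NeZero L], ∃ β₀ : ℝ, ∀ β : ℝ, β₀ ≤ β → ∃ M₀ : ℕ, ∀ M : ℕ, M₀ ≤ M →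
          ∀ [NeZero M], SymmetricCertifiedAtT π Θ a b Λ L M β (e L) (G L M β) (Z L M β) :=
  Iff.rfl

/-- Unfolding `symmetricRegimeCertificateT`. [folklore] -/
theorem symmetricRegimeCertificateT_iff (U μ : ℝ) (π : SymmetricRegimeDataT) (Θ : SymmetricTolerance)
    (K : TrigPolyC4v) (Λ : ℝ) (L₀ : ℕ) :
    symmetricRegimeCertificateT U μ π Θ K Λ L₀ ↔
      π.AdmitsFrameNorm (K.coeffNorm π.frameDecay) ∧ π.AdmitsScale Λ ∧
      ShellGeometry (renormalisedBandC μ K) Λ π.velLower π.velUpper π.curvLower π.curvUpper π.vanHoveDist ∧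
      ∃ a b : ℚ, symmetricWindowLower ≤ a ∧ a ≤ b ∧ b ≤ symmetricWindowUpper ∧ b - a ≤ Θ.width ∧
        ∀ L : ℕ, L₀ ≤ L → ∀ [NeZero L], ∃ β₀ : ℝ, ∀ β : ℝ, β₀ ≤ β → ∃ M₀ : ℕ, ∀ M : ℕ, M₀ ≤ M →
          ∀ [NeZero M], SymmetricCertifiedAtT π Θ a b Λ L M β (nambuXiCT L μ K)
            (hubbardEffectiveActionCT L M β U μ 0 K Λ) (hubbardEffPartitionFnCT L M β U μ 0 K Λ) :=
  Iff.rfl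

section Holds

variable {n : ℝ} {eC : (Fin 2 → ℝ) → ℝ} {Λ : ℝ} {L₀ : ℕ} {e : ∀ (L : ℕ) [NeZero L], TorusSite 2 L → ℝ}
  {G : ∀ (L M : ℕ) [NeZero L], ℝ → HubbardGrassmann L M} {Z : ∀ (L M : ℕ) [NeZero L], ℝ → ℂ}

/-- A certified frame norm is admissible. [folklore] -/
theorem SymmetricRegimeHoldsT.admitsFrameNorm (h : SymmetricRegimeHoldsT π Θ n eC Λ L₀ e G Z) :
    π.AdmitsFrameNorm n :=
  h.1

/-- A certified scale is admissible. [folklore] -/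
theorem SymmetricRegimeHoldsT.admitsScale (h : SymmetricRegimeHoldsT π Θ n eC Λ L₀ e G Z) :
    π.AdmitsScale Λ :=
  h.2.1

/-- A certified scale is positive. [folklore] -/
theorem SymmetricRegimeHoldsT.scale_pos (h : SymmetricRegimeHoldsT π Θ n eC Λ L₀ e G Z) : 0 < Λ :=
  h.2.1.pos

/-- A certified family has the shell geometry of `π`. [folklore] -/
theorem SymmetricRegimeHoldsT.shellGeometry (h : SymmetricRegimeHoldsT π Θ n eC Λ L₀ e G Z) :
    ShellGeometry eC Λ π.velLower π.velUpper π.curvLower π.curvUpper π.vanHoveDist :=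
  h.2.2.1

/-- Monotonicity in the volume threshold. [folklore] -/
theorem SymmetricRegimeHoldsT.mono {L₀' : ℕ} (hL : L₀ ≤ L₀') (h : SymmetricRegimeHoldsT π Θ n eC Λ L₀ e G Z) :
    SymmetricRegimeHoldsT π Θ n eC Λ L₀' e G Z := by
  obtain ⟨h1, h2, h3, a, b, ha, hab, hb, hw, hblock⟩ := h
  exact ⟨h1, h2, h3, a, b, ha, hab, hb, hw, fun L hL' => hblock L (hL.trans hL')⟩

/-- The exhibited enclosure has positive lower end: `0 < 1/8 ≤ a`. [folklore] -/
theorem SymmetricRegimeHoldsT.exists_window (h : SymmetricRegimeHoldsT π Θ n eC Λ L₀ e G Z) :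
    ∃ a b : ℚ, 0 < a ∧ a ≤ b ∧ b - a ≤ Θ.width ∧
      ∀ L : ℕ, L₀ ≤ L → ∀ [NeZero L], ∃ β₀ : ℝ, ∀ β : ℝ, β₀ ≤ β → ∃ M₀ : ℕ, ∀ M : ℕ, M₀ ≤ M →
        ∀ [NeZero M], SymmetricCertifiedAtT π Θ a b Λ L M β (e L) (G L M β) (Z L M β) := by
  obtain ⟨-, -, -, a, b, ha, hab, -, hw, hblock⟩ := h
  exact ⟨a, b, lt_of_lt_of_le (by norm_num [symmetricWindowLower]) ha, hab, hw, hblock⟩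

/-- **The weakening v2 ⇒ v3 for a family**: a v2 certificate of the family for the v2 part of `π` is a
v3 certificate with the same enclosure and thresholds up to `M₀ ↦ max M₀ m_max` (`|Γ| = 8L²M ≥ M ≥ m_max`
then, and `Λ > 0` by admissibility). [folklore] -/
theorem SymmetricRegimeHoldsT.of_R (h : SymmetricRegimeHoldsR π.toSymmetricRegimeDataR Θ n eC Λ L₀ e G Z) :
    SymmetricRegimeHoldsT π Θ n eC Λ L₀ e G Z := by
  obtain ⟨h1, h2, h3, a, b, ha, hab, hb, hw, hblock⟩ := h
  refine ⟨h1, h2, h3, a, b, ha, hab, hb, hw, ?_⟩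
  intro L hL _
  obtain ⟨β₀, hβ₀⟩ := hblock L hL
  refine ⟨β₀, fun β hβ => ?_⟩
  obtain ⟨M₀, hM₀⟩ := hβ₀ β hβ
  refine ⟨max M₀ π.remainderDegree, ?_⟩
  intro M hM _
  exact SymmetricCertifiedAtT.of_R h2.pos.le
    ((le_of_max_le_right hM).trans (le_card_hubbardFieldIdx L M)) (hM₀ M (le_of_max_le_left hM))

end Holds

section Model

variable {U μ : ℝ} {K : TrigPolyC4v} {Λ : ℝ} {L₀ : ℕ}

/-- A certified frame is admissible: `K.coeffNorm r ≤ κ_max`. [folklore] -/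
theorem symmetricRegimeCertificateT.coeffNorm_le (h : symmetricRegimeCertificateT U μ π Θ K Λ L₀) :
    K.coeffNorm π.frameDecay ≤ π.frameBound :=
  h.1

/-- A certified scale is admissible. [folklore] -/
theorem symmetricRegimeCertificateT.admitsScale (h : symmetricRegimeCertificateT U μ π Θ K Λ L₀) :
    π.AdmitsScale Λ :=
  h.2.1

/-- A certified scale is positive. [folklore] -/
theorem symmetricRegimeCertificateT.scale_pos (h : symmetricRegimeCertificateT U μ π Θ K Λ L₀) : 0 < Λ :=
  h.2.1.pos

/-- A certified frame has the shell geometry of `π`. [folklore] -/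
theorem symmetricRegimeCertificateT.shellGeometry (h : symmetricRegimeCertificateT U μ π Θ K Λ L₀) :
    ShellGeometry (renormalisedBandC μ K) Λ π.velLower π.velUpper π.curvLower π.curvUpper π.vanHoveDist :=
  h.2.2.1

/-- Monotonicity in the volume threshold. [folklore] -/
theorem symmetricRegimeCertificateT.mono {L₀' : ℕ} (hL : L₀ ≤ L₀')
    (h : symmetricRegimeCertificateT U μ π Θ K Λ L₀) : symmetricRegimeCertificateT U μ π Θ K Λ L₀' :=
  SymmetricRegimeHoldsT.mono hL h

/-- **The weakening v2 ⇒ v3 for the model**: a v2 certificate of the countertermed Hubbard action for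
the v2 part of `π` is a v3 certificate at the same `(U, μ, Θ, K, Λ, L₀)`. [folklore] -/
theorem symmetricRegimeCertificateT.of_R (h : symmetricRegimeCertificateR U μ π.toSymmetricRegimeDataR Θ K Λ L₀) :
    symmetricRegimeCertificateT U μ π Θ K Λ L₀ :=
  SymmetricRegimeHoldsT.of_R h

end Model

end API

/-! ### §5 Junk tests -/

section Junk

variable (π : SymmetricRegimeDataT) (Θ : SymmetricTolerance)

/-- **Junk test: the zero effective action is never v3-certified in an interval with `a > 0`**: its
pairing strength is `λ_d = 0 < a` (`pairingStrength_zero`). [folklore] -/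
theorem not_symmetricCertifiedAtT_zero {a : ℚ} (ha : 0 < a) (b : ℚ) (Λ : ℝ) (L M : ℕ) [NeZero L]
    [NeZero M] (β : ℝ) (e : TorusSite 2 L → ℝ) (Z : ℂ) :
    ¬ SymmetricCertifiedAtT π Θ a b Λ L M β e (0 : HubbardGrassmann L M) Z := by
  intro h
  have hax := h.window.1
  rw [pairingStrength_zero] at hax
  have : (0 : ℝ) < a := by exact_mod_cast ha
  linarith

/-- A model family whose effective action vanishes identically is never in the v3 symmetric regime.
[folklore] -/
theorem not_symmetricRegimeHoldsT_zero (n : ℝ) (eC : (Fin 2 → ℝ) → ℝ) (Λ : ℝ) (L₀ : ℕ)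
    (e : ∀ (L : ℕ) [NeZero L], TorusSite 2 L → ℝ) (Z : ∀ (L M : ℕ) [NeZero L], ℝ → ℂ) :
    ¬ SymmetricRegimeHoldsT π Θ n eC Λ L₀ e (fun L M _ _ => (0 : HubbardGrassmann L M)) Z := by
  intro h
  obtain ⟨a, b, ha, -, -, hblock⟩ := h.exists_window
  haveI : NeZero (L₀ + 1) := ⟨Nat.succ_ne_zero _⟩
  obtain ⟨β₀, hβ₀⟩ := hblock (L₀ + 1) (Nat.le_succ _)
  obtain ⟨M₀, hM₀⟩ := hβ₀ β₀ le_rfl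
  haveI : NeZero (M₀ + 1) := ⟨Nat.succ_ne_zero _⟩
  exact not_symmetricCertifiedAtT_zero π Θ ha b Λ (L₀ + 1) (M₀ + 1) β₀ (e (L₀ + 1)) (Z (L₀ + 1) (M₀ + 1) β₀)
    (hM₀ (M₀ + 1) (Nat.le_succ _))

/-- **Junk test (as requested): the v3 certificate is FALSE at `U = 0` in the bare frame `K = 0`**, for
every chemical potential, data, tolerance, scale and threshold — the free effective action vanishes
(`hubbardEffectiveActionCT_free_zero_frame`), so `λ_d = 0 ∉ [a, b]`, `a ≥ 1/8`. [folklore] -/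
theorem not_symmetricRegimeCertificateT_free (μ : ℝ) (Λ : ℝ) (L₀ : ℕ) :
    ¬ symmetricRegimeCertificateT 0 μ π Θ 0 Λ L₀ := by
  intro h
  obtain ⟨a, b, ha, -, -, hblock⟩ := SymmetricRegimeHoldsT.exists_window h
  haveI : NeZero (L₀ + 1) := ⟨Nat.succ_ne_zero _⟩
  obtain ⟨β₀, hβ₀⟩ := hblock (L₀ + 1) (Nat.le_succ _)
  obtain ⟨M₀, hM₀⟩ := hβ₀ β₀ le_rfl
  haveI : NeZero (M₀ + 1) := ⟨Nat.succ_ne_zero _⟩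
  have hc : SymmetricCertifiedAtT π Θ a b Λ (L₀ + 1) (M₀ + 1) β₀ (nambuXiCT (L₀ + 1) μ 0)
      (hubbardEffectiveActionCT (L₀ + 1) (M₀ + 1) β₀ 0 μ 0 0 Λ)
      (hubbardEffPartitionFnCT (L₀ + 1) (M₀ + 1) β₀ 0 μ 0 0 Λ) := hM₀ (M₀ + 1) (Nat.le_succ _)
  rw [hubbardEffectiveActionCT_free_zero_frame] at hc
  exact not_symmetricCertifiedAtT_zero π Θ ha b Λ (L₀ + 1) (M₀ + 1) β₀ _ _ hc

end Junk

end Literature.MathematicalPhysics.QuantumLattice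

end
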